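import Summits.AnomalousDissipation.AnomalousDissipation.Theorems.NeutralTaylorWavesTaylorWaveQuasiSteadyHierarchyEikonal
import Summits.AnomalousDissipation.AnomalousDissipation.Theorems.NeutralTaylorWavesTaylorWaveQuasiSteadyHierarchyUnfold
import Summits.AnomalousDissipation.AnomalousDissipation.Theorems.NeutralTaylorWavesTaylorWaveQuasiSteadyHierarchyEnergyLemmas

/-!
# The order-one fibre mean of the ε-free hierarchy: the force is determined by the leading profile
# (line `windfibred` rev 3; crux stmt-AnomalousDissipation-16293, `NeutralTaylorWaves.TaylorWaveQuasiSteady`)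

First structural consequence of the ε-free hierarchy of `Theorems/…Hierarchy.lean` at order `ε⁰`.  Write
`T⁴ = T³ × T¹` (slow point `x`, fast phase `θ` = last coordinate) and, over a slow point `x`, the FAST FIBRE
`s ↦ Fin.snoc x s : T¹ → T⁴`.  If smooth profiles solve `d_0 = 0`, `d_1 = 0` and the order-one equation
`M_1 = 0` (`divCoeff … 0/1`, `hierarchyCoeff … 1`, `1 ≤ N`), then at every slow point (`force_eq_fibre_mean`,
registered verbatim as the tools sub-stub `stub_hierarchyWForce`, last theorem)

  `f(x) = ∫_{T¹} [ (P_0·∇_x)P_0 + (div_x P_0) P_0 − c_0 ∂_{x_2}P_0 + ∇_x Q_0 ] (x, s) ds`.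

Proof.  `Unfold.hierarchyCoeff_of_le` at `t = 1` spells `M_1 (x, s) = 0` out (`hierarchyCoeff_one`):
`f x = (P_0·∇_x)P_0 + (P_0·k)∂_θP_1 + (P_1·k)∂_θP_0 − ∑ᵢ kᵢ∂_θ(kᵢ∂_θP_0) + ∇_xQ_0 + k∂_θQ_1 − c_0∂_{x_2}P_0`
`− c_0k_2∂_θP_1 − c_1k_2∂_θP_0` (`slow (x, s) = x`).  Integrate over the probability space `T¹` and use:
* the FIBRE LEMMA `∫_{T¹} ∂_θΦ(x, s) ds = 0` for smooth `Φ : T⁴ → F` (`integral_partialDeriv_last_fibre`: the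
  fibre function `t ↦ Φ(x, t mod 1)` has derivative `∂_θΦ` by `Torus.hasDerivAt_comp_add_proj_smul` and
  `DissipationLaw.snoc_add_single_last`, the Haar integral over `T¹` is an interval integral over one period
  (`Torus.integral_unitAddCircle_eq_intervalIntegral`), FTC and `(1 : ℝ/ℤ) = 0`), whence INTEGRATION BY PARTS
  along the fibre (`integral_smul_partialDeriv_last_fibre`, product rule `Torus.partialDeriv_smul`);
* slow factors are constant along the fibre, `∂_θ (g ∘ slow) = 0` (`Energy.partialDeriv_last_comp_slow`).
So every weighted fast derivative `kᵢ(x)∂_θ(·)` has zero fibre mean (viscous term, `k∂_θQ_1`, fast drift terms: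
`integral_fDeriv_fibre`, `integral_toLp_fDeriv_fibre`), and for the fast convection (`integral_convection_fibre`)
`∫ (Φ·k)∂_θΨ ds = −∫ (k·∂_θΦ) Ψ ds`: for `Φ = P_0, Ψ = P_1` the weight derivative is `k·∂_θP_0 = d_0 = 0`
(`Eikonal.divCoeff_zero`); for `Φ = P_1, Ψ = P_0` it is `k·∂_θP_1 = d_1 − div_x P_0 = −div_x P_0`
(`Unfold.divCoeff_succ`), which produces `(div_x P_0) P_0`.  Tree tools: the files just named,
`…HierarchyEnergyTools/Lemmas` (`Energy.partialDeriv_last_phaseGrad_mul`, `partialDeriv_apply_coord'`, smoothness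
bookkeeping), `…StubFormalExpansionW` (`isSmooth_fDeriv`), `Literature/…/TorusCalculusProofs` (`partialDeriv_smul`),
`TorusEnstrophyOrthogonality` (`partialDeriv_finset_sum`), `TorusAxisAverageCalculus` (`proj_smul_single`), Mathlib
interval-integral FTC.  Source: folklore (fast-period average of the order-`ε⁰` profile equation of monophase
nonlinear geometric optics; Cheverry–Guès–Métivier, Ann. Sci. ENS 36 (2003) §2).
-/

-- `Summit.<Summit>.<Problem>` is the tree's mandated summit-side namespace (CONVENTIONS §2); for this
-- single-conjunct summit the two coincide, so the duplicate is deliberate.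
set_option linter.dupNamespace false

noncomputable section

open scoped BigOperators Topology InnerProductSpace
open Filter MeasureTheory
open Literature.Analysis.FunctionSpaces Literature.Analysis.FunctionSpaces.Torus

namespace Summit.AnomalousDissipation.AnomalousDissipation.Theorems.TaylorWaveQuasiSteady.ForceIdentity

open Summit.AnomalousDissipation.AnomalousDissipation.Theorems.TaylorWaveQuasiSteady

/-! ## §1 Calculus along the fast fibre `s ↦ (x, s)` -/

variable {F : Type*} [NormedAddCommGroup F] [NormedSpace ℝ F]

/-- The fibre map `s ↦ (x, s) : T¹ → T⁴` over a slow point `x` is continuous. [folklore] -/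
theorem continuous_snoc_fibre (x : UnitAddTorus (Fin 3)) :
    Continuous fun s : UnitAddCircle => (Fin.snoc x s : UnitAddTorus (Fin 4)) :=
  (DissipationLaw.continuous_snoc_prod 3).comp (continuous_id.prodMk continuous_const)

omit [NormedSpace ℝ F] in
/-- Continuous profiles are integrable along every fast fibre (a compact probability space). [folklore] -/
theorem integrable_fastFibre {H : UnitAddTorus (Fin 4) → F} (hH : Continuous H) (x : UnitAddTorus (Fin 3)) :
    Integrable (fun s : UnitAddCircle => H (Fin.snoc x s)) volume :=
  (hH.comp (continuous_snoc_fibre x)).integrable_of_hasCompactSupport (HasCompactSupport.of_compactSpace _)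

/-- `slow (x, s) = x`. [folklore] -/
theorem slow_snoc (x : UnitAddTorus (Fin 3)) (s : UnitAddCircle) : slow (Fin.snoc x s) = x :=
  funext fun l => by simp only [slow, Fin.snoc_castSucc]

/-- The fibre function `t ↦ Φ (x, t mod 1)` of a `C¹` profile has derivative `∂_θ Φ (x, t mod 1)` everywhere
(`Torus.hasDerivAt_comp_add_proj_smul` along `e_θ` from the base point `(x, 0)`). [folklore] -/
theorem hasDerivAt_comp_snoc_coe {Φ : UnitAddTorus (Fin 4) → F} (hΦ : IsContDiff 1 Φ) (x : UnitAddTorus (Fin 3))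
    (t : ℝ) : HasDerivAt (fun t : ℝ => Φ (Fin.snoc x (t : UnitAddCircle)))
      (partialDeriv (Fin.last 3) Φ (Fin.snoc x (t : UnitAddCircle))) t := by
  have h := hasDerivAt_comp_add_proj_smul hΦ (Fin.snoc x 0) (EuclideanSpace.single (Fin.last 3) (1 : ℝ)) t
  simp only [proj_smul_single, DissipationLaw.snoc_add_single_last, zero_add] at h
  exact h

/-- **Fibre lemma**: `∫_{T¹} ∂_θ Φ (x, s) ds = 0` for a smooth profile `Φ : T⁴ → F` and every slow point `x`
(fundamental theorem of calculus over one period of the fibre function, `(1 : ℝ/ℤ) = 0`). [folklore] -/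
theorem integral_partialDeriv_last_fibre [CompleteSpace F] {Φ : UnitAddTorus (Fin 4) → F} (hΦ : IsSmooth Φ)
    (x : UnitAddTorus (Fin 3)) : ∫ s : UnitAddCircle, partialDeriv (Fin.last 3) Φ (Fin.snoc x s) = 0 := by
  rw [integral_unitAddCircle_eq_intervalIntegral]
  have hderiv : ∀ t ∈ Set.uIcc (0 : ℝ) 1, HasDerivAt (fun t : ℝ => Φ (Fin.snoc x (t : UnitAddCircle)))
      (partialDeriv (Fin.last 3) Φ (Fin.snoc x (t : UnitAddCircle))) t :=
    fun t _ => hasDerivAt_comp_snoc_coe (hΦ.isContDiff (by simp)) x t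
  have hint : IntervalIntegrable (fun t : ℝ => partialDeriv (Fin.last 3) Φ (Fin.snoc x (t : UnitAddCircle)))
      volume 0 1 :=
    (((hΦ.partialDeriv (Fin.last 3)).continuous.comp (continuous_snoc_fibre x)).comp
      continuous_quotient_mk').intervalIntegrable _ _
  rw [intervalIntegral.integral_eq_sub_of_hasDerivAt hderiv hint]
  have h1 : ((1 : ℝ) : UnitAddCircle) = 0 := AddCircle.coe_period 1
  have h0 : ((0 : ℝ) : UnitAddCircle) = 0 := AddCircle.coe_zero _
  rw [h1, h0, sub_self]

/-- **Integration by parts along the fibre**: `∫ a ∂_θB ds = −∫ (∂_θ a) B ds` for smooth `a : T⁴ → ℝ`,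
`B : T⁴ → F` (the fibre lemma for `a • B` and the product rule `Torus.partialDeriv_smul`). [folklore] -/
theorem integral_smul_partialDeriv_last_fibre [CompleteSpace F] {a : UnitAddTorus (Fin 4) → ℝ}
    {B : UnitAddTorus (Fin 4) → F} (ha : IsSmooth a) (hB : IsSmooth B) (x : UnitAddTorus (Fin 3)) :
    ∫ s : UnitAddCircle, a (Fin.snoc x s) • partialDeriv (Fin.last 3) B (Fin.snoc x s) =
      -∫ s : UnitAddCircle, partialDeriv (Fin.last 3) a (Fin.snoc x s) • B (Fin.snoc x s) := by
  have h0 := integral_partialDeriv_last_fibre (ha.smul' hB) x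
  have hprod : ∀ y, partialDeriv (Fin.last 3) (fun y => a y • B y) y =
      a y • partialDeriv (Fin.last 3) B y + partialDeriv (Fin.last 3) a y • B y :=
    fun y => partialDeriv_smul (ha.isContDiff (by simp)) (hB.isContDiff (by simp)) _ y
  simp only [hprod] at h0
  rw [integral_add (integrable_fastFibre (H := fun y => a y • partialDeriv (Fin.last 3) B y)
      (ha.continuous.smul (hB.partialDeriv _).continuous) x)
    (integrable_fastFibre (H := fun y => partialDeriv (Fin.last 3) a y • B y)
      ((ha.partialDeriv _).continuous.smul hB.continuous) x)] at h0
  exact eq_neg_of_add_eq_zero_left h0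

/-! ## §2 Weighted fast derivatives along the fibre -/

/-- Along the fibre over `x` the weight of `fDeriv` is the constant `kᵢ(x)`. [folklore] -/
theorem fDeriv_snoc (j : Fin 3 → ℤ) (G : UnitAddTorus (Fin 3) → ℝ) (i : Fin 3) (Φ : UnitAddTorus (Fin 4) → F)
    (x : UnitAddTorus (Fin 3)) (s : UnitAddCircle) :
    fDeriv j G i Φ (Fin.snoc x s) = phaseGrad j G i x • partialDeriv (Fin.last 3) Φ (Fin.snoc x s) := by
  rw [fDeriv, slow_snoc]

/-- **Weighted fast derivatives have zero fibre mean**: `∫_{T¹} kᵢ(x) ∂_θΦ (x, s) ds = 0`. [folklore] -/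
theorem integral_fDeriv_fibre [CompleteSpace F] (j : Fin 3 → ℤ) (G : UnitAddTorus (Fin 3) → ℝ) (i : Fin 3)
    {Φ : UnitAddTorus (Fin 4) → F} (hΦ : IsSmooth Φ) (x : UnitAddTorus (Fin 3)) :
    ∫ s : UnitAddCircle, fDeriv j G i Φ (Fin.snoc x s) = 0 := by
  simp only [fDeriv_snoc]
  rw [integral_smul, integral_partialDeriv_last_fibre hΦ x, smul_zero]

/-- A profile `T⁴ → ℝ^ι` with smooth coordinates is smooth. [folklore] -/
theorem isSmooth_toLp_fin {ι : Type*} [Fintype ι] {g : ι → UnitAddTorus (Fin 4) → ℝ} (hg : ∀ i, IsSmooth (g i)) :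
    IsSmooth (fun y => (WithLp.toLp 2 (fun i => g i y) : EuclideanSpace ℝ ι)) := by
  unfold IsSmooth
  rw [contDiff_piLp]
  exact fun i => hg i

/-- Convection sums `∑ₗ Φₗ Xₗ` of smooth profiles are smooth. [folklore] -/
theorem isSmooth_sum_apply_smul {Φ : UnitAddTorus (Fin 4) → EuclideanSpace ℝ (Fin 3)}
    {X : Fin 3 → UnitAddTorus (Fin 4) → F} (hΦ : IsSmooth Φ) (hX : ∀ l, IsSmooth (X l)) :
    IsSmooth (fun y => ∑ l : Fin 3, (Φ y) l • X l y) :=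
  Energy.isSmooth_fsum _ fun l _ => (Energy.isSmooth_coord hΦ l).smul' (hX l)

/-- The fast convection term is a weighted fast derivative: `∑ₗ Φₗ (kₗ∂_θΨ) = (k·Φ) ∂_θΨ`. [folklore] -/
theorem sum_apply_smul_fDeriv (j : Fin 3 → ℤ) (G : UnitAddTorus (Fin 3) → ℝ)
    (Φ : UnitAddTorus (Fin 4) → EuclideanSpace ℝ (Fin 3)) (Ψ : UnitAddTorus (Fin 4) → F) (y : UnitAddTorus (Fin 4)) :
    ∑ l : Fin 3, (Φ y) l • fDeriv j G l Ψ y =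
      (∑ l : Fin 3, phaseGrad j G l (slow y) * (Φ y) l) • partialDeriv (Fin.last 3) Ψ y := by
  rw [Finset.sum_smul]
  refine Finset.sum_congr rfl fun l _ => ?_
  rw [fDeriv, smul_smul, mul_comm]

/-- **Fast convection along the fibre, by parts**: `∫ ∑ₗ Φₗ kₗ∂_θΨ ds = −∫ (k·∂_θΦ) Ψ ds` (the weight `k·Φ` is
smooth with `∂_θ (k·Φ) = k·∂_θΦ`, `k` being slow: `Energy.partialDeriv_last_phaseGrad_mul`). [folklore] -/
theorem integral_convection_fibre [CompleteSpace F] (j : Fin 3 → ℤ) {G : UnitAddTorus (Fin 3) → ℝ}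
    (hG : IsSmooth G) {Φ : UnitAddTorus (Fin 4) → EuclideanSpace ℝ (Fin 3)} {Ψ : UnitAddTorus (Fin 4) → F}
    (hΦ : IsSmooth Φ) (hΨ : IsSmooth Ψ) (x : UnitAddTorus (Fin 3)) :
    ∫ s : UnitAddCircle, ∑ l : Fin 3, (Φ (Fin.snoc x s)) l • fDeriv j G l Ψ (Fin.snoc x s) =
      -∫ s : UnitAddCircle, (∑ l : Fin 3, (fDeriv j G l Φ (Fin.snoc x s)) l) • Ψ (Fin.snoc x s) := by
  have hkc : ∀ l, IsSmooth (fun y : UnitAddTorus (Fin 4) => phaseGrad j G l (slow y) * (Φ y) l) := fun l =>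
    Energy.isSmooth_mul (Energy.isSmooth_phaseGrad_slow j hG l) (Energy.isSmooth_coord hΦ l)
  have hw : IsSmooth (fun y : UnitAddTorus (Fin 4) => ∑ l : Fin 3, phaseGrad j G l (slow y) * (Φ y) l) :=
    Energy.isSmooth_fsum _ fun l _ => hkc l
  have hdw : ∀ y, partialDeriv (Fin.last 3) (fun y => ∑ l : Fin 3, phaseGrad j G l (slow y) * (Φ y) l) y =
      ∑ l : Fin 3, (fDeriv j G l Φ y) l := fun y => by
    rw [partialDeriv_finset_sum _ (fun l _ => (hkc l).isContDiff (by simp))]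
    refine Finset.sum_congr rfl fun l _ => ?_
    rw [Energy.partialDeriv_last_phaseGrad_mul j hG l (Energy.isSmooth_coord hΦ l),
      Energy.partialDeriv_apply_coord' (hΦ.isContDiff (by simp)), fDeriv, PiLp.smul_apply, smul_eq_mul]
  have hfun : (fun s : UnitAddCircle => partialDeriv (Fin.last 3)
        (fun y => ∑ l : Fin 3, phaseGrad j G l (slow y) * (Φ y) l) (Fin.snoc x s) • Ψ (Fin.snoc x s)) =
      fun s => (∑ l : Fin 3, (fDeriv j G l Φ (Fin.snoc x s)) l) • Ψ (Fin.snoc x s) :=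
    funext fun s => by rw [hdw]
  simp only [sum_apply_smul_fDeriv j G Φ Ψ]
  rw [integral_smul_partialDeriv_last_fibre hw hΨ x, hfun]

/-- **The fast pressure gradient has zero fibre mean**: `∫ (kᵢ(x) ∂_θR (x, s))ᵢ ds = 0`. [folklore] -/
theorem integral_toLp_fDeriv_fibre (j : Fin 3 → ℤ) {G : UnitAddTorus (Fin 3) → ℝ} (hG : IsSmooth G)
    {R : UnitAddTorus (Fin 4) → ℝ} (hR : IsSmooth R) (x : UnitAddTorus (Fin 3)) :
    ∫ s : UnitAddCircle,
      (WithLp.toLp 2 (fun i : Fin 3 => fDeriv j G i R (Fin.snoc x s)) : EuclideanSpace ℝ (Fin 3)) = 0 := by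
  have hint : Integrable (fun s : UnitAddCircle =>
      (WithLp.toLp 2 (fun i : Fin 3 => fDeriv j G i R (Fin.snoc x s)) : EuclideanSpace ℝ (Fin 3))) volume :=
    integrable_fastFibre
      (H := fun y => (WithLp.toLp 2 (fun i : Fin 3 => fDeriv j G i R y) : EuclideanSpace ℝ (Fin 3)))
      (isSmooth_toLp_fin fun i => FormalExpansion.isSmooth_fDeriv j hG i hR).continuous x
  ext i
  exact ((EuclideanSpace.proj i : EuclideanSpace ℝ (Fin 3) →L[ℝ] ℝ).integral_comp_comm hint).symm.trans
    (integral_fDeriv_fibre j G i hR x)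

/-! ## §3 The order-one equation and its fibre mean -/

variable {j : Fin 3 → ℤ} {G : UnitAddTorus (Fin 3) → ℝ} {f : UnitAddTorus (Fin 3) → EuclideanSpace ℝ (Fin 3)} {N : ℕ}
  {P : ℕ → UnitAddTorus (Fin 4) → EuclideanSpace ℝ (Fin 3)} {Q : ℕ → UnitAddTorus (Fin 4) → ℝ} {c : ℕ → ℝ}

/-- **The order-one equation of the hierarchy** (`1 ≤ N`), term by term:
`M_1 = (P_0·∇_x)P_0 + [(P_0·k)∂_θP_1 + (P_1·k)∂_θP_0] − ∑ᵢ kᵢ∂_θ(kᵢ∂_θP_0) + (∇_xQ_0 + k∂_θQ_1) − c_0∂_{x_2}P_0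
 − [c_0k_2∂_θP_1 + c_1k_2∂_θP_0] − f ∘ slow`. [folklore] -/
theorem hierarchyCoeff_one (j : Fin 3 → ℤ) (G : UnitAddTorus (Fin 3) → ℝ)
    (f : UnitAddTorus (Fin 3) → EuclideanSpace ℝ (Fin 3)) {N : ℕ}
    (P : ℕ → UnitAddTorus (Fin 4) → EuclideanSpace ℝ (Fin 3))
    (Q : ℕ → UnitAddTorus (Fin 4) → ℝ) (c : ℕ → ℝ) (hN : 1 ≤ N) (y : UnitAddTorus (Fin 4)) :
    hierarchyCoeff j G f N P Q c 1 y =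
      (∑ l : Fin 3, (P 0 y) l • sDeriv l (P 0) y)
      + ((∑ l : Fin 3, (P 0 y) l • fDeriv j G l (P 1) y) + ∑ l : Fin 3, (P 1 y) l • fDeriv j G l (P 0) y)
      - (∑ i : Fin 3, fDeriv j G i (fDeriv j G i (P 0)) y)
      + WithLp.toLp 2 (fun i : Fin 3 => sDeriv i (Q 0) y + fDeriv j G i (Q 1) y)
      - c 0 • sDeriv 2 (P 0) y
      - (c 0 • fDeriv j G 2 (P 1) y + c 1 • fDeriv j G 2 (P 0) y)
      - f (slow y) := by
  rw [Unfold.hierarchyCoeff_of_le j G f N P Q c 1 le_rfl hN y, if_neg (by norm_num), if_neg (by norm_num), if_pos rfl]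
  simp only [Finset.sum_range_succ, Finset.sum_range_zero, zero_add, Nat.sub_self, Nat.sub_zero, sub_zero]

/-- **The force is the fibre mean of the slow momentum-flux divergence of the leading profile.**  If `G, P_a, Q_a`
are smooth, `1 ≤ N`, `d_0 ≡ 0`, `d_1 ≡ 0` and `M_1 ≡ 0`, then for every slow point `x`,
`f x = ∫_{T¹} [(P_0·∇_x)P_0 + (div_x P_0)P_0 − c_0∂_{x_2}P_0 + ∇_xQ_0](x, s) ds`. [folklore] -/
theorem force_eq_fibre_mean (hG : IsSmooth G) (hP : ∀ a, IsSmooth (P a)) (hQ : ∀ a, IsSmooth (Q a)) (hN : 1 ≤ N)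
    (hd0 : ∀ y, divCoeff j G N P 0 y = 0) (hd1 : ∀ y, divCoeff j G N P 1 y = 0)
    (hM1 : ∀ y, hierarchyCoeff j G f N P Q c 1 y = 0) (x : UnitAddTorus (Fin 3)) :
    f x = ∫ s : UnitAddCircle, ((∑ l : Fin 3, (P 0 (Fin.snoc x s)) l • sDeriv l (P 0) (Fin.snoc x s))
      + (∑ i : Fin 3, (sDeriv i (P 0) (Fin.snoc x s)) i) • P 0 (Fin.snoc x s) - c 0 • sDeriv 2 (P 0) (Fin.snoc x s)
      + WithLp.toLp 2 (fun i : Fin 3 => sDeriv i (Q 0) (Fin.snoc x s))) := by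
  -- smoothness of the building blocks
  have hsD : ∀ (a : ℕ) (i : Fin 3), IsSmooth (sDeriv i (P a)) := fun a i => (hP a).partialDeriv i.castSucc
  have hsDQ : ∀ (a : ℕ) (i : Fin 3), IsSmooth (sDeriv i (Q a)) := fun a i => (hQ a).partialDeriv i.castSucc
  have hfD : ∀ (a : ℕ) (i : Fin 3), IsSmooth (fDeriv j G i (P a)) := fun a i =>
    FormalExpansion.isSmooth_fDeriv j hG i (hP a)
  have hfDQ : ∀ (a : ℕ) (i : Fin 3), IsSmooth (fDeriv j G i (Q a)) := fun a i =>
    FormalExpansion.isSmooth_fDeriv j hG i (hQ a)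
  -- integrability of every term along the fibre
  have iA : Integrable (fun s : UnitAddCircle =>
      ∑ l : Fin 3, (P 0 (Fin.snoc x s)) l • sDeriv l (P 0) (Fin.snoc x s)) volume :=
    integrable_fastFibre (H := fun y => ∑ l : Fin 3, (P 0 y) l • sDeriv l (P 0) y)
      (isSmooth_sum_apply_smul (hP 0) (hsD 0)).continuous x
  have iB1 : Integrable (fun s : UnitAddCircle =>
      ∑ l : Fin 3, (P 0 (Fin.snoc x s)) l • fDeriv j G l (P 1) (Fin.snoc x s)) volume :=
    integrable_fastFibre (H := fun y => ∑ l : Fin 3, (P 0 y) l • fDeriv j G l (P 1) y)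
      (isSmooth_sum_apply_smul (hP 0) (hfD 1)).continuous x
  have iB2 : Integrable (fun s : UnitAddCircle =>
      ∑ l : Fin 3, (P 1 (Fin.snoc x s)) l • fDeriv j G l (P 0) (Fin.snoc x s)) volume :=
    integrable_fastFibre (H := fun y => ∑ l : Fin 3, (P 1 y) l • fDeriv j G l (P 0) y)
      (isSmooth_sum_apply_smul (hP 1) (hfD 0)).continuous x
  have iV : Integrable (fun s : UnitAddCircle =>
      ∑ i : Fin 3, fDeriv j G i (fDeriv j G i (P 0)) (Fin.snoc x s)) volume :=
    integrable_fastFibre (H := fun y => ∑ i : Fin 3, fDeriv j G i (fDeriv j G i (P 0)) y)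
      (Energy.isSmooth_fsum _ fun i _ => FormalExpansion.isSmooth_fDeriv j hG i (hfD 0 i)).continuous x
  have iPr : Integrable (fun s : UnitAddCircle =>
      (WithLp.toLp 2 (fun i : Fin 3 => sDeriv i (Q 0) (Fin.snoc x s) + fDeriv j G i (Q 1) (Fin.snoc x s)) :
        EuclideanSpace ℝ (Fin 3))) volume :=
    integrable_fastFibre (H := fun y => (WithLp.toLp 2 (fun i : Fin 3 => sDeriv i (Q 0) y + fDeriv j G i (Q 1) y) :
      EuclideanSpace ℝ (Fin 3))) (isSmooth_toLp_fin fun i => (hsDQ 0 i).add (hfDQ 1 i)).continuous x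
  have iPr0 : Integrable (fun s : UnitAddCircle =>
      (WithLp.toLp 2 (fun i : Fin 3 => sDeriv i (Q 0) (Fin.snoc x s)) : EuclideanSpace ℝ (Fin 3))) volume :=
    integrable_fastFibre
      (H := fun y => (WithLp.toLp 2 (fun i : Fin 3 => sDeriv i (Q 0) y) : EuclideanSpace ℝ (Fin 3)))
      (isSmooth_toLp_fin fun i => hsDQ 0 i).continuous x
  have iPr1 : Integrable (fun s : UnitAddCircle =>
      (WithLp.toLp 2 (fun i : Fin 3 => fDeriv j G i (Q 1) (Fin.snoc x s)) : EuclideanSpace ℝ (Fin 3))) volume :=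
    integrable_fastFibre
      (H := fun y => (WithLp.toLp 2 (fun i : Fin 3 => fDeriv j G i (Q 1) y) : EuclideanSpace ℝ (Fin 3)))
      (isSmooth_toLp_fin fun i => hfDQ 1 i).continuous x
  have iD1 : Integrable (fun s : UnitAddCircle => c 0 • sDeriv 2 (P 0) (Fin.snoc x s)) volume :=
    integrable_fastFibre (H := fun y => c 0 • sDeriv 2 (P 0) y) ((hsD 0 2).smul (c 0)).continuous x
  have iD2 : Integrable (fun s : UnitAddCircle => c 0 • fDeriv j G 2 (P 1) (Fin.snoc x s)) volume :=
    integrable_fastFibre (H := fun y => c 0 • fDeriv j G 2 (P 1) y) ((hfD 1 2).smul (c 0)).continuous x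
  have iD3 : Integrable (fun s : UnitAddCircle => c 1 • fDeriv j G 2 (P 0) (Fin.snoc x s)) volume :=
    integrable_fastFibre (H := fun y => c 1 • fDeriv j G 2 (P 0) y) ((hfD 0 2).smul (c 1)).continuous x
  have i23 : Integrable (fun s : UnitAddCircle =>
      c 0 • fDeriv j G 2 (P 1) (Fin.snoc x s) + c 1 • fDeriv j G 2 (P 0) (Fin.snoc x s)) volume := iD2.add iD3
  have iDiv : Integrable (fun s : UnitAddCircle =>
      (∑ i : Fin 3, (sDeriv i (P 0) (Fin.snoc x s)) i) • P 0 (Fin.snoc x s)) volume :=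
    integrable_fastFibre (H := fun y => (∑ i : Fin 3, (sDeriv i (P 0) y) i) • P 0 y)
      ((Energy.isSmooth_fsum _ fun i _ => Energy.isSmooth_coord (hsD 0 i) i).smul' (hP 0)).continuous x
  -- the fibre means of the fast terms
  have vB1 : ∫ s : UnitAddCircle, ∑ l : Fin 3, (P 0 (Fin.snoc x s)) l • fDeriv j G l (P 1) (Fin.snoc x s) = 0 := by
    have hzero : (fun s : UnitAddCircle =>
        (∑ l : Fin 3, (fDeriv j G l (P 0) (Fin.snoc x s)) l) • P 1 (Fin.snoc x s)) = fun _ => 0 :=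
      funext fun s => by rw [← Eikonal.divCoeff_zero j G N P, hd0, zero_smul]
    rw [integral_convection_fibre j hG (hP 0) (hP 1) x, hzero, integral_zero, neg_zero]
  have vB2 : ∫ s : UnitAddCircle, ∑ l : Fin 3, (P 1 (Fin.snoc x s)) l • fDeriv j G l (P 0) (Fin.snoc x s) =
      ∫ s : UnitAddCircle, (∑ i : Fin 3, (sDeriv i (P 0) (Fin.snoc x s)) i) • P 0 (Fin.snoc x s) := by
    have hfun : (fun s : UnitAddCircle =>
          -((∑ l : Fin 3, (fDeriv j G l (P 1) (Fin.snoc x s)) l) • P 0 (Fin.snoc x s))) =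
        fun s => (∑ i : Fin 3, (sDeriv i (P 0) (Fin.snoc x s)) i) • P 0 (Fin.snoc x s) := by
      funext s
      have h := Unfold.divCoeff_succ j G N P 0 hN (Fin.snoc x s)
      rw [zero_add, hd1] at h
      rw [eq_neg_of_add_eq_zero_right h.symm, neg_smul, neg_neg]
    rw [integral_convection_fibre j hG (hP 1) (hP 0) x, ← integral_neg, hfun]
  have vV : ∫ s : UnitAddCircle, ∑ i : Fin 3, fDeriv j G i (fDeriv j G i (P 0)) (Fin.snoc x s) = 0 := by
    rw [integral_finsetSum _ fun i _ =>
      integrable_fastFibre (H := fDeriv j G i (fDeriv j G i (P 0)))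
        (FormalExpansion.isSmooth_fDeriv j hG i (hfD 0 i)).continuous x]
    exact Finset.sum_eq_zero fun i _ => integral_fDeriv_fibre j G i (hfD 0 i) x
  have vPr : ∫ s : UnitAddCircle, (WithLp.toLp 2 (fun i : Fin 3 =>
        sDeriv i (Q 0) (Fin.snoc x s) + fDeriv j G i (Q 1) (Fin.snoc x s)) : EuclideanSpace ℝ (Fin 3)) =
      ∫ s : UnitAddCircle,
        (WithLp.toLp 2 (fun i : Fin 3 => sDeriv i (Q 0) (Fin.snoc x s)) : EuclideanSpace ℝ (Fin 3)) := by
    rw [← add_zero (∫ s : UnitAddCircle,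
        (WithLp.toLp 2 (fun i : Fin 3 => sDeriv i (Q 0) (Fin.snoc x s)) : EuclideanSpace ℝ (Fin 3))),
      ← integral_toLp_fDeriv_fibre j hG (hQ 1) x, ← integral_add iPr0 iPr1]
    rfl
  have vD : ∫ s : UnitAddCircle,
      (c 0 • fDeriv j G 2 (P 1) (Fin.snoc x s) + c 1 • fDeriv j G 2 (P 0) (Fin.snoc x s)) = 0 := by
    rw [integral_add iD2 iD3, integral_smul, integral_smul, integral_fDeriv_fibre j G 2 (hP 1) x,
      integral_fDeriv_fibre j G 2 (hP 0) x, smul_zero, smul_zero, add_zero]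
  -- the order-one equation along the fibre, solved for the force
  have hpt : ∀ s : UnitAddCircle, f x =
      (∑ l : Fin 3, (P 0 (Fin.snoc x s)) l • sDeriv l (P 0) (Fin.snoc x s))
      + ((∑ l : Fin 3, (P 0 (Fin.snoc x s)) l • fDeriv j G l (P 1) (Fin.snoc x s))
        + ∑ l : Fin 3, (P 1 (Fin.snoc x s)) l • fDeriv j G l (P 0) (Fin.snoc x s))
      - (∑ i : Fin 3, fDeriv j G i (fDeriv j G i (P 0)) (Fin.snoc x s))
      + WithLp.toLp 2 (fun i : Fin 3 => sDeriv i (Q 0) (Fin.snoc x s) + fDeriv j G i (Q 1) (Fin.snoc x s))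
      - c 0 • sDeriv 2 (P 0) (Fin.snoc x s)
      - (c 0 • fDeriv j G 2 (P 1) (Fin.snoc x s) + c 1 • fDeriv j G 2 (P 0) (Fin.snoc x s)) := by
    intro s
    have h := hM1 (Fin.snoc x s)
    rw [hierarchyCoeff_one j G f P Q c hN, slow_snoc, sub_eq_zero] at h
    exact h.symm
  -- integrate over the fibre (a probability space) and split both sides (`Eq.trans` matches the partial
  -- sums up to unfolding of the pointwise operations)
  rw [show f x = ∫ _s : UnitAddCircle, f x by rw [integral_const, probReal_univ, one_smul],
    integral_congr_ae (ae_of_all _ hpt)]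
  refine (integral_sub ((((iA.add (iB1.add iB2)).sub iV).add iPr).sub iD1) i23).trans ?_
  refine (congrArg (· - _) (integral_sub (((iA.add (iB1.add iB2)).sub iV).add iPr) iD1)).trans ?_
  refine (congrArg (fun z => z - _ - _) (integral_add ((iA.add (iB1.add iB2)).sub iV) iPr)).trans ?_
  refine (congrArg (fun z => z + _ - _ - _) (integral_sub (iA.add (iB1.add iB2)) iV)).trans ?_
  refine (congrArg (fun z => z - _ + _ - _ - _) (integral_add iA (iB1.add iB2))).trans ?_
  refine (congrArg (fun z => _ + z - _ + _ - _ - _) (integral_add iB1 iB2)).trans ?_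
  refine Eq.trans ?_ (integral_add ((iA.add iDiv).sub iD1) iPr0).symm
  refine Eq.trans ?_ (congrArg (· + _) (integral_sub (iA.add iDiv) iD1)).symm
  refine Eq.trans ?_ (congrArg (fun z => z - _ + _) (integral_add iA iDiv)).symm
  rw [vB1, vB2, vV, vPr, vD]
  abel

/-! ## §4 The registered tools sub-stub -/

/-- **stub_hierarchyWForce** (registered tools sub-stub of stmt-AnomalousDissipation-16293, verbatim): at order `ε⁰`
the hierarchy determines the force as the fibre mean of the slow momentum-flux divergence of the leading profile,
`f(x) = ∫_{T¹} [(P_0·∇_x)P_0 + (div_xP_0)P_0 − c_0∂_{x_2}P_0 + ∇_xQ_0](x, s) ds` (`force_eq_fibre_mean`). [folklore] -/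
theorem stub_hierarchyWForce : ∀ (j : Fin 3 → ℤ) (G : UnitAddTorus (Fin 3) → ℝ) (f : UnitAddTorus (Fin 3) → EuclideanSpace ℝ (Fin 3)) (N : ℕ) (P : ℕ → UnitAddTorus (Fin 4) → EuclideanSpace ℝ (Fin 3)) (Q : ℕ → UnitAddTorus (Fin 4) → ℝ) (c : ℕ → ℝ), Literature.Analysis.FunctionSpaces.Torus.IsSmooth G → (∀ a, Literature.Analysis.FunctionSpaces.Torus.IsSmooth (P a)) → (∀ a, Literature.Analysis.FunctionSpaces.Torus.IsSmooth (Q a)) → 1 ≤ N → (∀ y, divCoeff j G N P 0 y = 0) → (∀ y, divCoeff j G N P 1 y = 0) → (∀ y, hierarchyCoeff j G f N P Q c 1 y = 0) → ∀ x : UnitAddTorus (Fin 3), f x = ∫ s : UnitAddCircle, ((∑ l : Fin 3, (P 0 (@Fin.snoc 3 (fun _ => UnitAddCircle) x s)) l • sDeriv l (P 0) (@Fin.snoc 3 (fun _ => UnitAddCircle) x s)) + (∑ i : Fin 3, (sDeriv i (P 0) (@Fin.snoc 3 (fun _ => UnitAddCircle) x s)) i) • P 0 (@Fin.snoc 3 (fun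 _ => UnitAddCircle) x s) - c 0 • sDeriv 2 (P 0) (@Fin.snoc 3 (fun _ => UnitAddCircle) x s) + WithLp.toLp 2 (fun i : Fin 3 => sDeriv i (Q 0) (@Fin.snoc 3 (fun _ => UnitAddCircle) x s))) :=
  fun _ _ _ _ _ _ _ hG hP hQ hN hd0 hd1 hM1 x => force_eq_fibre_mean hG hP hQ hN hd0 hd1 hM1 x

end Summit.AnomalousDissipation.AnomalousDissipation.Theorems.TaylorWaveQuasiSteady.ForceIdentity

end
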